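import Summits.CriticalPhenomena.SAWScalingLimit.Theorems.SimpleSubseqLimits.Negative.SimpleSubseqLimitsCore
import Summits.CriticalPhenomena.SAWScalingLimit.Theorems.SimpleSubseqLimits.Negative.SimpleSubseqLimitsFalseWithoutEndpointLimits
import Summits.CriticalPhenomena.SAWScalingLimit.Theorems.SubseqIdentification.Negative.ProbabilityRedundant

/-!
# Negative-side results for the crux `SAWLoopFugacityFlow.SimpleSubseqLimits` (stmt-CriticalPhenomena-4982):
the COMPLETE hypothesis ledger (work-file §11–§12)

The crux `S` (shared verbatim by SAWSteinDefect / SAWTensorRG / SAWFrontierHomotopy) has five hypotheses: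
`IsEndpointApprox D a b` (= `reachable` ∧ `tendsto_fst` ∧ `tendsto_snd`), `Tendsto s atTop (𝓝[>] 0)`,
`IsProbabilityMeasure ν`, and the weak convergence `WeakLimitAlong D a b s ν`. Earlier files settled
`tendsto_fst` / `tendsto_snd` (load-bearing: `SimpleSubseqLimitsFalseWithoutEndpointLimits`) and `reachable`
(idle: `simpleSubseqLimits_iff_withoutReachable`). Here the remaining entries (weakened statements written
inline in the theorem types):

* `simpleSubseqLimits_iff_withoutIsProbability` — the hypothesis `IsProbabilityMeasure ν` is IDLE: it follows
  from the others (sibling lemma `SubseqIdentification.Negative.isProbabilityMeasure_of_hyps`, reused: test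
  function `1`; Lean's `∫ 1 dν = ν.real univ` reads `0` on infinite measures);
* `simpleSubseqLimits_false_without_isProbability_and_reachable` — but `IsProbabilityMeasure ν` and
  `reachable` are JOINTLY load-bearing: dropping both makes `S` FALSE (endpoint `b δ` one step OUTSIDE the
  disc ⇒ all laws `0`; `ν = ∞ • δ_{constant curve}` has all test integrals `0` by the junk value of `∫`);
* `simpleSubseqLimits_false_without_meshLimit` — the LIMIT in `s n → 0⁺` is load-bearing: with only
  `0 < s n` (take `s ≡ δ₁`) the weak limit is the honest law at mesh `δ₁`, carried by polylines starting at
  an interior mesh point `≠ a`;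
* `simpleSubseqLimits_false_with_twoSidedMeshLimit` — the SIDE `> 0` is load-bearing: with
  `Tendsto s atTop (𝓝 0)` negative meshes are admitted, where `IsEndpointApprox` constrains nothing
  (coincident endpoints ⇒ Dirac mass at a constant curve);
* `simpleSubseqLimits_false_without_weakLimit` — dropping the convergence hypothesis is (of course) fatal.

Refuter `cdisprove` (gen 2); indexed work file: `Summits/…/Cruxes/SimpleSubseqLimits/Disproof.lean`.
-/

noncomputable section

open MeasureTheory Filter Topology Set Metric
open Literature.Probability.RandomPlanarGeometry Literature.Probability.RandomPlanarGeometry.SAW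
open Literature.Probability.LatticeModels Literature.Probability.Percolation
open scoped ENNReal NNReal BoundedContinuousFunction

namespace Summit.CriticalPhenomena.SAWScalingLimit.Theorems.SimpleSubseqLimits.Negative

open Summit.CriticalPhenomena.SAWScalingLimit.Theses.SAWLoopFugacityFlow (SimpleSubseqLimits)

/-! ## Two facts at a fixed positive mesh (the honesty of the laws for small `δ > 0` is
`SubseqIdentification.Negative.eventually_isProbabilityMeasure_law`, reused) -/

section HonestLaws

/-- Distinct limits force distinct endpoints for all small `δ > 0`. [folklore] -/
theorem eventually_ne_nhdsGT {D : DobrushinDomain} {a b : ℝ → Site 2} (hab : IsEndpointApprox D a b) :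
    ∀ᶠ δ in 𝓝[>] (0 : ℝ), a δ ≠ b δ := by
  have hne : D.pt 0 ≠ D.pt 1 := fun h => absurd (D.pt_injective h) (by decide)
  obtain ⟨U, V, hU, hV, hxU, hyV, hUV⟩ := t2_separation hne
  filter_upwards [hab.tendsto_fst.eventually (hU.mem_nhds hxU),
    hab.tendsto_snd.eventually (hV.mem_nhds hyV)] with δ ha hb h
  rw [h] at ha
  exact Set.disjoint_iff.1 hUV ⟨ha, hb⟩

/-- At a fixed mesh, a SAW between distinct joined vertices starts at an INTERIOR mesh point, never at
the boundary point `a = D.pt 0`; so no approximant ever satisfies the carrier clause. [folklore] -/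
theorem curve_source_ne_pt {D : DobrushinDomain} {δ : ℝ} {u v : Site 2} (huv : u ≠ v)
    (γ : DomainSAW D.carrier δ u v) : γ.curve.source ≠ D.pt 0 := by
  have hu : u ∈ meshDomain D.carrier δ := by
    cases hγ : γ.walk with
    | nil => exact absurd rfl huv
    | cons hadj _ => exact (discreteDomainGraph_adj_iff.1 hadj).2.1
  have hin : meshPoint δ u ∈ D.carrier := meshDomain_subset_meshVertices _ _ hu
  have hsrc : γ.curve.source = meshPoint δ u := by
    simp only [DomainSAW.curve, CurveClass.source_mk, Curve.source_def]
    exact SimpleGraph.Walk.toCurve_apply_zero _ _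
  rw [hsrc]
  intro h
  have hfr := D.pt_mem_frontier 0
  rw [← h, frontier, D.isOpen.interior_eq] at hfr
  exact hfr.2 hin

end HonestLaws

/-! ## §11 `IsProbabilityMeasure ν` is idle — but jointly load-bearing with `reachable` -/

section ProbabilityIdle

/-- **`IsProbabilityMeasure ν` is idle**: `S` ⟺ `S` without it. No `_false_without_isProbability`
theorem can exist; provers get the instance for free from
`SubseqIdentification.Negative.isProbabilityMeasure_of_hyps` (test function `1`: the laws are
probability measures for small `δ > 0`, and `∫ 1 dν = ν.real univ` for EVERY measure). [folklore] -/
theorem simpleSubseqLimits_iff_withoutIsProbability :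
    SimpleSubseqLimits ↔
      ∀ (D : DobrushinDomain) (a b : ℝ → Site 2), IsEndpointApprox D a b →
        ∀ (s : ℕ → ℝ) (ν : Measure (CurveClass ℂ)), Tendsto s atTop (𝓝[>] (0 : ℝ)) →
          WeakLimitAlong D a b s ν → ∀ᵐ γ ∂ν, Carrier D γ := by
  constructor
  · intro h D a b hab s ν hs hw
    exact h D a b hab s ν hs (SubseqIdentification.Negative.isProbabilityMeasure_of_hyps hab hs hw) hw
  · intro h D a b hab s ν hs _ hw
    exact h D a b hab s ν hs hw

/-- No SAW reaches a site outside the discrete domain. [folklore] -/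
theorem isEmpty_domainSAW_of_not_mem {Ω : Set ℂ} {δ : ℝ} {u v : Site 2} (huv : u ≠ v)
    (hv : v ∉ meshDomain Ω δ) : IsEmpty (DomainSAW Ω δ u v) := by
  refine ⟨fun γ => ?_⟩
  cases hγ : γ.walk.reverse with
  | nil => exact huv rfl
  | cons hadj _ => exact hv (discreteDomainGraph_adj_iff.1 hadj).2.1

/-- Towards an unreachable endpoint the law is the zero measure. [folklore] -/
theorem law_eq_zero_of_not_mem {Ω : Set ℂ} {δ : ℝ} {u v : Site 2} (huv : u ≠ v)
    (hv : v ∉ meshDomain Ω δ) : law Ω δ u v = 0 := by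
  haveI := isEmpty_domainSAW_of_not_mem huv hv
  exact Measure.eq_zero_of_isEmpty _

/-- The endpoint family `b δ := nearestSite δ (-1 - 3δ)`: its mesh point is within `δ` of `-1 - 3δ`,
hence OUTSIDE the closed unit disc for `δ > 0`, yet it converges to `-1 = unitDisc.pt 1`. [folklore] -/
theorem norm_meshPoint_outside {δ : ℝ} (hδ : 0 < δ) :
    1 + 2 * δ ≤ ‖meshPoint δ (nearestSite δ (-1 - 3 * δ))‖ := by
  have h1 := dist_meshPoint_nearestSite_le hδ (-1 - 3 * δ : ℂ)
  rw [dist_eq_norm] at h1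
  have h2 : ‖(-1 - 3 * δ : ℂ)‖ = 1 + 3 * δ := by
    have : (-1 - 3 * δ : ℂ) = ((-(1 + 3 * δ) : ℝ) : ℂ) := by push_cast; ring
    rw [this, Complex.norm_real, Real.norm_eq_abs, abs_neg, abs_of_pos (by linarith)]
  have h3 := norm_sub_norm_le (-1 - 3 * δ : ℂ) (meshPoint δ (nearestSite δ (-1 - 3 * δ)))
  rw [← norm_neg, neg_sub] at h1
  linarith

/-- The outside family still approximates `-1`. [folklore] -/
theorem tendsto_meshPoint_outside :
    Tendsto (fun δ : ℝ => meshPoint δ (nearestSite δ (-1 - 3 * δ))) (𝓝[>] (0 : ℝ)) (𝓝 (-1)) := by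
  rw [tendsto_iff_dist_tendsto_zero]
  have h0 : Tendsto (fun δ : ℝ => 4 * δ) (𝓝[>] (0 : ℝ)) (𝓝 0) := by
    have : Tendsto (fun δ : ℝ => 4 * δ) (𝓝 (0 : ℝ)) (𝓝 (4 * 0)) :=
      tendsto_const_nhds.mul tendsto_id
    rw [mul_zero] at this
    exact this.mono_left nhdsWithin_le_nhds
  refine squeeze_zero' (Eventually.of_forall fun _ => dist_nonneg) ?_ h0
  filter_upwards [self_mem_nhdsWithin] with δ hδ
  have hδ' : (0 : ℝ) < δ := hδ
  calc dist (meshPoint δ (nearestSite δ (-1 - 3 * δ))) (-1)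
      ≤ dist (meshPoint δ (nearestSite δ (-1 - 3 * δ))) (-1 - 3 * δ) + dist (-1 - 3 * δ : ℂ) (-1) :=
        dist_triangle _ _ _
    _ ≤ δ + 3 * δ := by
        refine add_le_add (dist_meshPoint_nearestSite_le hδ' _) ?_
        rw [dist_eq_norm]
        have : (-1 - 3 * δ : ℂ) - (-1) = ((-(3 * δ) : ℝ) : ℂ) := by push_cast; ring
        rw [this, Complex.norm_real, Real.norm_eq_abs, abs_neg, abs_of_pos (by linarith)]
    _ = 4 * δ := by ring

/-- **`IsProbabilityMeasure ν` and `reachable` are JOINTLY load-bearing**: dropping both makes `S`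
FALSE. Witness in the unit disc: `a δ = nearestSite δ 1`, `b δ = nearestSite δ (-1 - 3δ)` (mesh point
outside the disc ⇒ `b δ ∉ Ω_δ` ⇒ every law is `0`), `ν = ∞ • δ_{constant curve at 0}`: all test
integrals vanish on both sides (Lean's `∫ f ∂(∞ • μ) = 0`), yet `ν`-a.e. means `δ`-a.e. and the constant
class is not simple. [folklore] -/
theorem simpleSubseqLimits_false_without_isProbability_and_reachable :
    ¬ ∀ (D : DobrushinDomain) (a b : ℝ → Site 2),
        Tendsto (fun δ => meshPoint δ (a δ)) (𝓝[>] (0 : ℝ)) (𝓝 (D.pt 0)) →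
        Tendsto (fun δ => meshPoint δ (b δ)) (𝓝[>] (0 : ℝ)) (𝓝 (D.pt 1)) →
        ∀ (s : ℕ → ℝ) (ν : Measure (CurveClass ℂ)), Tendsto s atTop (𝓝[>] (0 : ℝ)) →
          WeakLimitAlong D a b s ν → ∀ᵐ γ ∂ν, Carrier D γ := by
  intro h
  set D := DobrushinDomain.unitDisc with hD
  let a : ℝ → Site 2 := fun δ => nearestSite δ 1
  let b : ℝ → Site 2 := fun δ => nearestSite δ (-1 - 3 * δ)
  let c₀ : CurveClass ℂ := CurveClass.mk (Curve.const 0)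
  let ν : Measure (CurveClass ℂ) := (∞ : ℝ≥0∞) • Measure.dirac c₀
  have hpt0 : D.pt 0 = 1 := by
    simp [hD, MarkedDomain.pt, DobrushinDomain.unitDisc, JordanDomain.unitDisc, circleMap]
  have hpt1 : D.pt 1 = -1 := by
    simp [hD, MarkedDomain.pt, DobrushinDomain.unitDisc, JordanDomain.unitDisc, circleMap]
    rw [show (2 * (Real.pi : ℂ) * 2⁻¹ * Complex.I) = Real.pi * Complex.I by ring]
    exact Complex.exp_pi_mul_I
  have ha : Tendsto (fun δ => meshPoint δ (a δ)) (𝓝[>] (0 : ℝ)) (𝓝 (D.pt 0)) := by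
    rw [hpt0]; exact tendsto_meshPoint_nearestSite 1
  have hb : Tendsto (fun δ => meshPoint δ (b δ)) (𝓝[>] (0 : ℝ)) (𝓝 (D.pt 1)) := by
    rw [hpt1]; exact tendsto_meshPoint_outside
  -- all laws along `1/(n+1)` vanish
  have hlaw : ∀ {δ : ℝ}, 0 < δ → law D.carrier δ (a δ) (b δ) = 0 := by
    intro δ hδ
    have hout : b δ ∉ meshDomain D.carrier δ := fun hm => by
      have hin : meshPoint δ (b δ) ∈ Metric.ball (0 : ℂ) 1 := meshDomain_subset_meshVertices _ _ hm
      rw [Metric.mem_ball, dist_zero_right] at hin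
      have := norm_meshPoint_outside hδ
      linarith
    have hne : a δ ≠ b δ := by
      intro hab
      have h1 : ‖meshPoint δ (a δ)‖ ≤ 1 + δ := by
        have := dist_meshPoint_nearestSite_le hδ (1 : ℂ)
        rw [dist_eq_norm] at this
        have h' := norm_le_norm_add_norm_sub' (meshPoint δ (nearestSite δ 1)) (1 : ℂ)
        rw [norm_one] at h'
        show ‖meshPoint δ (nearestSite δ 1)‖ ≤ 1 + δ
        linarith
      have h2 := norm_meshPoint_outside hδ
      rw [hab] at h1
      change 1 + 2 * δ ≤ ‖meshPoint δ (b δ)‖ at h2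
      linarith
    exact law_eq_zero_of_not_mem hne hout
  have hw : WeakLimitAlong D a b (fun n => 1 / ((n : ℝ) + 1)) ν := by
    intro f
    have hl : ∀ n : ℕ, ∫ γ, f γ.curve ∂(law D.carrier (1 / ((n : ℝ) + 1)) (a (1 / ((n : ℝ) + 1)))
        (b (1 / ((n : ℝ) + 1)))) = 0 := fun n => by
      rw [hlaw (by positivity)]; simp
    have hr : ∫ x, f x ∂ν = 0 := by
      simp only [ν, integral_smul_measure, ENNReal.toReal_top, zero_smul]
    simp only [hl, hr]
    exact tendsto_const_nhds
  have hae := h D a b ha hb _ ν tendsto_one_div_succ hw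
  rw [Measure.ae_ennreal_smul_measure_eq ENNReal.top_ne_zero] at hae
  exact not_ae_simple_dirac_const 0 (hae.mono fun γ hγ => hγ.1)

end ProbabilityIdle

/-! ## §12 The mesh hypothesis `s n → 0⁺`: both the limit and the side are load-bearing -/

section MeshHypothesis

/-- **The limit `s n → 0` is load-bearing**: `S` with only `0 < s n` is FALSE. Witness: any Dobrushin
domain, any honest approximation, the CONSTANT sequence `s ≡ δ₁` at a small honest mesh; the weak limit is
the pushed-forward law at mesh `δ₁` itself, a probability measure carried by polylines whose source is the
interior mesh point `δ₁ · a δ₁ ≠ a` (`curve_source_ne_pt`). [folklore] -/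
theorem simpleSubseqLimits_false_without_meshLimit :
    ¬ ∀ (D : DobrushinDomain) (a b : ℝ → Site 2), IsEndpointApprox D a b →
        ∀ (s : ℕ → ℝ) (ν : Measure (CurveClass ℂ)), (∀ n, 0 < s n) →
          IsProbabilityMeasure ν → WeakLimitAlong D a b s ν → ∀ᵐ γ ∂ν, Carrier D γ := by
  intro h
  set D := DobrushinDomain.unitDisc with hD
  obtain ⟨a, b, hab⟩ := exists_isEndpointApprox D
  obtain ⟨δ₁, hP, hne, hδ₁⟩ := ((SubseqIdentification.Negative.eventually_isProbabilityMeasure_law hab).and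
    ((eventually_ne_nhdsGT hab).and self_mem_nhdsWithin)).exists
  haveI := hP
  let P := law D.carrier δ₁ (a δ₁) (b δ₁)
  let ν : Measure (CurveClass ℂ) := P.map fun γ => γ.curve
  haveI hν : IsProbabilityMeasure ν :=
    Measure.isProbabilityMeasure_map (DomainSAW.measurable_of_top _).aemeasurable
  have hw : WeakLimitAlong D a b (fun _ => δ₁) ν := by
    intro f
    have : ∫ x, f x ∂ν = ∫ γ, f γ.curve ∂P :=
      integral_map (DomainSAW.measurable_of_top _).aemeasurable f.continuous.aestronglyMeasurable
    rw [this]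
    exact tendsto_const_nhds
  have hae := h D a b hab (fun _ => δ₁) ν (fun _ => hδ₁) hν hw
  have hae' : ∀ᵐ γ ∂P, Carrier D γ.curve :=
    ae_of_ae_map (DomainSAW.measurable_of_top _).aemeasurable hae
  have hfalse : ∀ᵐ γ ∂P, False :=
    hae'.mono fun γ hγ => curve_source_ne_pt hne γ hγ.2.1
  rw [eventually_false_iff_eq_bot, ae_eq_bot] at hfalse
  exact (IsProbabilityMeasure.ne_zero P) hfalse

/-- `IsEndpointApprox` only sees `δ > 0`: overriding the endpoints at `δ ≤ 0` preserves it. [folklore] -/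
theorem isEndpointApprox_override {D : DobrushinDomain} {a b : ℝ → Site 2} (hab : IsEndpointApprox D a b)
    (e : Site 2) :
    IsEndpointApprox D (fun δ => if 0 < δ then a δ else e) (fun δ => if 0 < δ then b δ else e) := by
  have hev : ∀ᶠ δ in 𝓝[>] (0 : ℝ), 0 < δ := self_mem_nhdsWithin
  refine ⟨?_, ?_, ?_⟩
  · filter_upwards [hab.reachable, hev] with δ hr hδ
    simp only [if_pos hδ]
    exact hr
  · refine hab.tendsto_fst.congr' ?_
    filter_upwards [hev] with δ hδ
    simp only [if_pos hδ]
  · refine hab.tendsto_snd.congr' ?_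
    filter_upwards [hev] with δ hδ
    simp only [if_pos hδ]

/-- **The side `> 0` is load-bearing**: `S` with the two-sided `s n → 0` is FALSE. Witness: the unit
disc, an honest approximation overridden at `δ ≤ 0` by the coincident endpoints `0, 0` (where
`IsEndpointApprox` says nothing), `s n = -1/(n+1)`: every law along the sequence is the Dirac mass at the
trivial walk, the weak limit is the Dirac mass at the constant curve at `0`, not simple. [folklore] -/
theorem simpleSubseqLimits_false_with_twoSidedMeshLimit :
    ¬ ∀ (D : DobrushinDomain) (a b : ℝ → Site 2), IsEndpointApprox D a b →
        ∀ (s : ℕ → ℝ) (ν : Measure (CurveClass ℂ)), Tendsto s atTop (𝓝 (0 : ℝ)) →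
          IsProbabilityMeasure ν → WeakLimitAlong D a b s ν → ∀ᵐ γ ∂ν, Carrier D γ := by
  intro h
  set D := DobrushinDomain.unitDisc with hD
  obtain ⟨a, b, hab⟩ := exists_isEndpointApprox D
  have hab' := isEndpointApprox_override hab 0
  let s : ℕ → ℝ := fun n => -(1 / ((n : ℝ) + 1))
  have hs : Tendsto s atTop (𝓝 (0 : ℝ)) := by
    have h0 : Tendsto (fun n : ℕ => 1 / ((n : ℝ) + 1)) atTop (𝓝 (0 : ℝ)) :=
      tendsto_one_div_add_atTop_nhds_zero_nat
    have h1 := h0.neg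
    rw [neg_zero] at h1
    exact h1
  have hsn : ∀ n, ¬ (0 < s n) := fun n => by
    simp only [s, not_lt, neg_nonpos]; positivity
  let ν : Measure (CurveClass ℂ) := Measure.dirac (CurveClass.mk (Curve.const 0))
  have hw : WeakLimitAlong D (fun δ => if 0 < δ then a δ else 0) (fun δ => if 0 < δ then b δ else 0) s ν := by
    intro f
    have hl : ∀ n, ∫ γ, f γ.curve ∂(law D.carrier (s n) (if 0 < s n then a (s n) else 0)
        (if 0 < s n then b (s n) else 0)) = f (CurveClass.mk (Curve.const 0)) := fun n => by
      have h0 : meshPoint (s n) (0 : Site 2) = 0 := by apply Complex.ext <;> simp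
      rw [integral_law_congr (if_neg (hsn n)) (if_neg (hsn n)), integral_law_self, h0]
    simp only [hl, ν, integral_dirac]
    exact tendsto_const_nhds
  have hae := h D _ _ hab' s ν hs inferInstance hw
  exact not_ae_simple_dirac_const 0 (hae.mono fun γ hγ => hγ.1)

/-- Dropping the convergence hypothesis is fatal (`ν` = Dirac mass at a constant curve). [folklore] -/
theorem simpleSubseqLimits_false_without_weakLimit :
    ¬ ∀ (D : DobrushinDomain) (a b : ℝ → Site 2), IsEndpointApprox D a b →
        ∀ (s : ℕ → ℝ) (ν : Measure (CurveClass ℂ)), Tendsto s atTop (𝓝[>] (0 : ℝ)) →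
          IsProbabilityMeasure ν → ∀ᵐ γ ∂ν, Carrier D γ := by
  intro h
  obtain ⟨a, b, hab⟩ := exists_isEndpointApprox DobrushinDomain.unitDisc
  have hae := h _ a b hab (fun n => 1 / ((n : ℝ) + 1)) (Measure.dirac (CurveClass.mk (Curve.const 0)))
    tendsto_one_div_succ inferInstance
  exact not_ae_simple_dirac_const 0 (hae.mono fun γ hγ => hγ.1)

end MeshHypothesis

end Summit.CriticalPhenomena.SAWScalingLimit.Theorems.SimpleSubseqLimits.Negative
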